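import Literature.Analysis.FluidPDE.CorrectorFourierSymmetry
import HarnessLib

/-!
# Lattice convolution and transport symbol at the order-four base: the toolkit of the `H⁴` ball

Analysis/FluidPDE proof file (theorems only), first of the files `PerturbedNSFourier*` proving
**short-time existence of smooth solutions of the perturbed Navier–Stokes system** (the
Cheskidov–Luo perturbation / corrector system around a smooth divergence-free background `u`,
Cheskidov–Luo 2022, §3.1 (3.2), here with a NONZERO datum, zero stress and a general viscosity)

  `∂ₜv + (v·∇)v + (u·∇)v + (v·∇)u + ∇q = νΔv`, `div v = 0`, `v(t₀) = v₀`, `∫ v = 0`,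

on `[t₀, t₀ + θ] × T^d` (`#d ≤ 3`) with a life span `θ` depending on the datum only through a
bound of its fourth Sobolev sums (Majda–Bertozzi 2002, Thm. 3.4: the `H^m` life span,
`m > d/2 + 1`). As for the zero-datum system (`CorrectorFourier*`) and the linearised system
(`LinearisedNSFourier*`) the solution is constructed on the Fourier side by Picard iteration of
the mild formulation in weighted sup-norms on the frequency lattice `ℤ^d` (sup norm
`‖m‖ = maxᵢ |mᵢ|`, weights `(1 + ‖m‖)^{-K}` of `FourierNS.HasDecay`; Lemarié-Rieusset 2016,
§8.5). The tree's lattice toolkit (`ScalarFourierFamily`) convolves at the summable order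
`2#d`; a fourth-Sobolev bound of the datum only controls the order-FOUR weight
(`GalerkinSmooth.hasDecay_of_weighted_sq_le`), so the contraction has to be run in the ball of
order `4`, one derivative being lost by the transport symbol and regained by the heat factor.
This file is the order-four twin of the convolution part of `ScalarFourierFamily`, valid on any
lattice on which the order-four weight is summable (mass `Z = ∑ₘ (1 + ‖m‖)^{-4}`, a hypothesis
`HasSum … Z`; it holds for `#d ≤ 3`, file `PerturbedNSFourierEstimates`):

* `norm_mul_norm_le_mixed_four` — the pointwise mixed bound: if `f` decays to orders `4` and
  `K + 1` and `g` to orders `3` and `K`, then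
  `‖f m‖ ‖g(k-m)‖ ≤ 2^K (1+‖k‖)^{-K} (A B₃ (¼(1+‖m‖)^{-4} + ¾(1+‖k-m‖)^{-4}) + A₄ B (1+‖m‖)^{-4})`
  (Peetre `(1+‖k‖)^K ≤ 2^K((1+‖k-m‖)^K + (1+‖m‖)^K)` and Young `xy³ ≤ x⁴/4 + 3y⁴/4` for the
  non-summable product `(1+‖m‖)^{-1}(1+‖k-m‖)^{-3}`);
* `hasDecay_lconv_mixed_four` — `‖(f ⋆ g)(k)‖ ≤ 2^K Z (A B₃ + A₄ B)(1+‖k‖)^{-K}`, linear in the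
  top-order constants; summability and parametric continuity of the convolution
  (`summable_lconv_term_four`, `continuous_lconv_param_four`);
* `hasDecay_transportSym_four` — the transport symbol `N(U, c)` of drift and scalar coefficients
  of orders `4` and `K + 1` decays to order `K` (one derivative lost on `c`); linearity
  (`transportSym_sub_four`, `transportSym_sub_left_four`), parametric continuity, and the
  vanishing at the zero frequency for Fourier-divergence-free drifts
  (`transportSym_zero_of_divFree_four`, the Fourier form of `∫ (u·∇)f = 0`).

## References

* A. J. Majda, A. L. Bertozzi, *Vorticity and Incompressible Flow*, CUP 2002, Thm. 3.4. [`MajdaBertozziCUP2002`]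
* A. Cheskidov, X. Luo, *Sharp nonuniqueness for the Navier–Stokes equations*, Invent. Math. 229
  (2022), §3.1 (3.2). [`CheskidovLuo2022`]
* P. G. Lemarié-Rieusset, *The Navier–Stokes problem in the 21st century*, CRC 2016, §8.5.
-/

noncomputable section

open MeasureTheory Real Set Filter Topology UnitAddTorus

namespace Literature.Analysis.FluidPDE

namespace PerturbedNSFourier

open ScalarFourier
open FourierNS (HasDecay)
open Literature.Analysis.FunctionSpaces.Torus (freqNormSq)

variable {d : Type*} [Fintype d] {Z : ℝ}

/-! ### The order-four weight -/

section Weights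

omit [Fintype d] in
/-- Young's inequality with exponents `4` and `4/3`: `x y³ ≤ x⁴/4 + 3y⁴/4` for `x, y ≥ 0`
(`x⁴ + 3y⁴ - 4xy³ = (x - y)²(x² + 2xy + 3y²)`). [folklore] -/
theorem mul_cube_le (x y : ℝ) (hx : 0 ≤ x) (hy : 0 ≤ y) :
    x * y ^ 3 ≤ 1 / 4 * x ^ 4 + 3 / 4 * y ^ 4 := by
  nlinarith [mul_nonneg (sq_nonneg (x - y))
    (add_nonneg (add_nonneg (sq_nonneg x) (mul_nonneg (mul_nonneg zero_le_two hx) hy))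
      (mul_nonneg zero_le_three (sq_nonneg y)))]

/-- The non-summable product of weights is dominated by summable ones:
`(1+‖m‖)^{-1} (1+‖n‖)^{-3} ≤ ¼ (1+‖m‖)^{-4} + ¾ (1+‖n‖)^{-4}`. [folklore] -/
theorem inv_mul_inv_cube_le (m n : d → ℤ) :
    (1 + ‖m‖)⁻¹ * ((1 + ‖n‖) ^ 3)⁻¹ ≤ 1 / 4 * ((1 + ‖m‖) ^ 4)⁻¹ + 3 / 4 * ((1 + ‖n‖) ^ 4)⁻¹ := by
  have hm : (0 : ℝ) < 1 + ‖m‖ := by positivity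
  have hn : (0 : ℝ) < 1 + ‖n‖ := by positivity
  have h := mul_cube_le (1 + ‖m‖)⁻¹ (1 + ‖n‖)⁻¹ (inv_nonneg.2 hm.le) (inv_nonneg.2 hn.le)
  simpa only [inv_pow] using h

/-- Translation invariance of the order-four mass: `∑ₘ (1 + ‖k - m‖)^{-4} = Z`. [folklore] -/
theorem hasSum_weight_four_sub (hZ : HasSum (fun m : d → ℤ => ((1 + ‖m‖) ^ 4)⁻¹) Z) (k : d → ℤ) :
    HasSum (fun m : d → ℤ => ((1 + ‖k - m‖) ^ 4)⁻¹) Z :=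
  ((Equiv.subLeft k).hasSum_iff (f := fun m : d → ℤ => ((1 + ‖m‖) ^ 4)⁻¹) (a := Z)).2 hZ

/-- The order-four mass is nonnegative. [folklore] -/
theorem weight_four_mass_nonneg (hZ : HasSum (fun m : d → ℤ => ((1 + ‖m‖) ^ 4)⁻¹) Z) : 0 ≤ Z :=
  hZ.nonneg fun m => by positivity

/-- A coefficient sequence decaying to order four is absolutely summable (when the order-four
weight is). [folklore] -/
theorem summable_norm_of_hasDecay_four (hZ : HasSum (fun m : d → ℤ => ((1 + ‖m‖) ^ 4)⁻¹) Z)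
    {C : ℝ} {f : (d → ℤ) → ℂ} (hf : HasDecay 4 C f) : Summable fun m => ‖f m‖ :=
  Summable.of_nonneg_of_le (fun _ => norm_nonneg _) (fun m => hf m) (hZ.summable.mul_left C)

end Weights

/-! ### The lattice convolution at the order-four base -/

section Conv

variable {K : ℕ} {A₄ A B₃ B M : ℝ} {f g : (d → ℤ) → ℂ}

/-- **Pointwise mixed bound at the order-four base.** If `f` decays to orders `4` (constant
`A₄`) and `K + 1` (constant `A`), and `g` to orders `3` (`B₃`) and `K` (`B`), then
`‖f m‖ ‖g(k-m)‖ ≤ 2^K (1+‖k‖)^{-K} (A B₃ (¼(1+‖m‖)^{-4} + ¾(1+‖k-m‖)^{-4}) + A₄ B (1+‖m‖)^{-4})`: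
Peetre's inequality puts the weight `(1+‖k‖)^K` on one factor at a time
(`FourierNS.one_add_norm_pow_le`); on `f` it leaves `A (1+‖m‖)^{-1}` against
`B₃ (1+‖k-m‖)^{-3}`, a product dominated by summable weights (`inv_mul_inv_cube_le`). [folklore] -/
theorem norm_mul_norm_le_mixed_four {k m : d → ℤ} (hA : 0 ≤ A) (hB₃ : 0 ≤ B₃) (hB : 0 ≤ B)
    (hf₄ : ‖f m‖ ≤ A₄ * ((1 + ‖m‖) ^ 4)⁻¹) (hf : ‖f m‖ ≤ A * ((1 + ‖m‖) ^ (K + 1))⁻¹)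
    (hg₃ : ‖g (k - m)‖ ≤ B₃ * ((1 + ‖k - m‖) ^ 3)⁻¹) (hg : ‖g (k - m)‖ ≤ B * ((1 + ‖k - m‖) ^ K)⁻¹) :
    ‖f m‖ * ‖g (k - m)‖ ≤ 2 ^ K * ((1 + ‖k‖) ^ K)⁻¹ *
      (A * B₃ * (1 / 4 * ((1 + ‖m‖) ^ 4)⁻¹ + 3 / 4 * ((1 + ‖k - m‖) ^ 4)⁻¹) +
        A₄ * B * ((1 + ‖m‖) ^ 4)⁻¹) := by
  set a := 1 + ‖k - m‖ with ha_def
  set b := 1 + ‖m‖ with hb_def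
  set P := ‖f m‖ with hP_def
  set Q := ‖g (k - m)‖ with hQ_def
  have ha : 0 < a := by positivity
  have hb : 0 < b := by positivity
  have haK : 0 < a ^ K := by positivity
  have hbK : 0 < b ^ K := by positivity
  have hkK : 0 < (1 + ‖k‖) ^ K := by positivity
  have hP : 0 ≤ P := norm_nonneg _
  have hQ : 0 ≤ Q := norm_nonneg _
  have hA₄ : 0 ≤ A₄ * (b ^ 4)⁻¹ := hP.trans hf₄
  -- the weight `a^K` is absorbed by `g`
  have h1 : a ^ K * Q ≤ B := by
    calc a ^ K * Q ≤ a ^ K * (B * (a ^ K)⁻¹) := mul_le_mul_of_nonneg_left hg haK.le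
      _ = B := by field_simp
  -- the weight `b^K` is absorbed by `f`, leaving `b⁻¹`
  have h2 : b ^ K * P ≤ A * b⁻¹ := by
    calc b ^ K * P ≤ b ^ K * (A * (b ^ (K + 1))⁻¹) := mul_le_mul_of_nonneg_left hf hbK.le
      _ = A * b⁻¹ := by rw [pow_succ]; field_simp
  have h3 : b ^ K * P * Q ≤ A * B₃ * (1 / 4 * (b ^ 4)⁻¹ + 3 / 4 * (a ^ 4)⁻¹) := by
    calc b ^ K * P * Q ≤ A * b⁻¹ * (B₃ * (a ^ 3)⁻¹) :=
          mul_le_mul h2 hg₃ hQ (mul_nonneg hA (inv_nonneg.2 hb.le))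
      _ = A * B₃ * (b⁻¹ * (a ^ 3)⁻¹) := by ring
      _ ≤ A * B₃ * (1 / 4 * (b ^ 4)⁻¹ + 3 / 4 * (a ^ 4)⁻¹) :=
          mul_le_mul_of_nonneg_left (inv_mul_inv_cube_le m (k - m)) (mul_nonneg hA hB₃)
  have h4 : a ^ K * Q * P ≤ A₄ * B * (b ^ 4)⁻¹ := by
    calc a ^ K * Q * P ≤ B * (A₄ * (b ^ 4)⁻¹) := mul_le_mul h1 hf₄ hP hB
      _ = A₄ * B * (b ^ 4)⁻¹ := by ring
  have key : (1 + ‖k‖) ^ K * (P * Q) ≤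
      2 ^ K * (A * B₃ * (1 / 4 * (b ^ 4)⁻¹ + 3 / 4 * (a ^ 4)⁻¹) + A₄ * B * (b ^ 4)⁻¹) := by
    calc (1 + ‖k‖) ^ K * (P * Q) ≤ 2 ^ K * (a ^ K + b ^ K) * (P * Q) :=
          mul_le_mul_of_nonneg_right (FourierNS.one_add_norm_pow_le k m K) (mul_nonneg hP hQ)
      _ = 2 ^ K * (b ^ K * P * Q + a ^ K * Q * P) := by ring
      _ ≤ 2 ^ K * (A * B₃ * (1 / 4 * (b ^ 4)⁻¹ + 3 / 4 * (a ^ 4)⁻¹) + A₄ * B * (b ^ 4)⁻¹) := by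
          gcongr
  rw [mul_comm] at key
  have := (le_div_iff₀ hkK).2 key
  calc P * Q ≤ 2 ^ K * (A * B₃ * (1 / 4 * (b ^ 4)⁻¹ + 3 / 4 * (a ^ 4)⁻¹) + A₄ * B * (b ^ 4)⁻¹) /
        (1 + ‖k‖) ^ K := this
    _ = _ := by rw [div_eq_mul_inv]; ring

/-- The sum of the dominating family of `norm_mul_norm_le_mixed_four`:
`2^K Z (A B₃ + A₄ B) (1+‖k‖)^{-K}`. [folklore] -/
theorem hasSum_mixedBound_four (hZ : HasSum (fun m : d → ℤ => ((1 + ‖m‖) ^ 4)⁻¹) Z)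
    (A₄ A B₃ B : ℝ) (K : ℕ) (k : d → ℤ) :
    HasSum (fun m : d → ℤ => 2 ^ K * ((1 + ‖k‖) ^ K)⁻¹ *
      (A * B₃ * (1 / 4 * ((1 + ‖m‖) ^ 4)⁻¹ + 3 / 4 * ((1 + ‖k - m‖) ^ 4)⁻¹) +
        A₄ * B * ((1 + ‖m‖) ^ 4)⁻¹))
      (2 ^ K * Z * (A * B₃ + A₄ * B) * ((1 + ‖k‖) ^ K)⁻¹) := by
  have h := ((((hZ.mul_left (1 / 4)).add ((hasSum_weight_four_sub hZ k).mul_left (3 / 4))).mul_left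
    (A * B₃)).add (hZ.mul_left (A₄ * B))).mul_left (2 ^ K * ((1 + ‖k‖) ^ K)⁻¹)
  have heq : 2 ^ K * ((1 + ‖k‖) ^ K)⁻¹ * (A * B₃ * (1 / 4 * Z + 3 / 4 * Z) + A₄ * B * Z) =
      2 ^ K * Z * (A * B₃ + A₄ * B) * ((1 + ‖k‖) ^ K)⁻¹ := by ring
  rw [heq] at h
  exact h

/-- Summability of the convolution family for `f` of order four and `g` bounded. [folklore] -/
theorem summable_lconv_term_four (hZ : HasSum (fun m : d → ℤ => ((1 + ‖m‖) ^ 4)⁻¹) Z)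
    (hf : HasDecay 4 A f) (hg : ∀ m, ‖g m‖ ≤ M) (k : d → ℤ) :
    Summable fun m => f m * g (k - m) := by
  refine Summable.of_norm_bounded (hZ.summable.mul_left (A * M)) fun m => ?_
  rw [norm_mul]
  have hM : 0 ≤ M := (norm_nonneg _).trans (hg 0)
  calc ‖f m‖ * ‖g (k - m)‖ ≤ A * ((1 + ‖m‖) ^ 4)⁻¹ * M :=
        mul_le_mul (hf m) (hg _) (norm_nonneg _) (mul_nonneg hf.nonneg (by positivity))
    _ = A * M * ((1 + ‖m‖) ^ 4)⁻¹ := by ring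

/-- **Mixed-weight convolution estimate at the order-four base**: if `f` decays to orders `4`,
`K + 1` (constants `A₄`, `A`) and `g` to orders `3`, `K` (constants `B₃`, `B`), then
`‖(f ⋆ g)(k)‖ ≤ 2^K Z (A B₃ + A₄ B) (1 + ‖k‖)^{-K}` — linear in the top-order constants
`A`, `B` (Lemarié-Rieusset 2016, §8.5). [folklore] -/
theorem norm_lconv_le_mixed_four (hZ : HasSum (fun m : d → ℤ => ((1 + ‖m‖) ^ 4)⁻¹) Z)
    (hA : 0 ≤ A) (hB₃ : 0 ≤ B₃) (hB : 0 ≤ B) (hf₄ : HasDecay 4 A₄ f) (hf : HasDecay (K + 1) A f)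
    (hg₃ : HasDecay 3 B₃ g) (hg : HasDecay K B g) (k : d → ℤ) :
    ‖lconv f g k‖ ≤ 2 ^ K * Z * (A * B₃ + A₄ * B) * ((1 + ‖k‖) ^ K)⁻¹ :=
  tsum_of_norm_bounded (hasSum_mixedBound_four hZ A₄ A B₃ B K k) fun m => by
    rw [norm_mul]
    exact norm_mul_norm_le_mixed_four hA hB₃ hB (hf₄ m) (hf m) (hg₃ (k - m)) (hg (k - m))

/-- The convolution of sequences of orders `(4, K+1)` and `(3, K)` decays to order `K`. [folklore] -/
theorem hasDecay_lconv_mixed_four (hZ : HasSum (fun m : d → ℤ => ((1 + ‖m‖) ^ 4)⁻¹) Z)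
    (hA : 0 ≤ A) (hB₃ : 0 ≤ B₃) (hB : 0 ≤ B) (hf₄ : HasDecay 4 A₄ f) (hf : HasDecay (K + 1) A f)
    (hg₃ : HasDecay 3 B₃ g) (hg : HasDecay K B g) :
    HasDecay K (2 ^ K * Z * (A * B₃ + A₄ * B)) (lconv f g) := fun k =>
  norm_lconv_le_mixed_four hZ hA hB₃ hB hf₄ hf hg₃ hg k

/-- **Continuity of a parametrised lattice convolution** at the order-four base: `F x` of order
four uniformly, `G x` bounded uniformly, both continuous at each frequency (Mathlib
`continuous_tsum`). [folklore] -/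
theorem continuous_lconv_param_four {X : Type*} [TopologicalSpace X] {F G : X → (d → ℤ) → ℂ}
    (hZ : HasSum (fun m : d → ℤ => ((1 + ‖m‖) ^ 4)⁻¹) Z)
    (hF : ∀ m, Continuous fun x => F x m) (hG : ∀ m, Continuous fun x => G x m)
    (hFd : ∀ x, HasDecay 4 A (F x)) (hGb : ∀ x m, ‖G x m‖ ≤ M) (k : d → ℤ) :
    Continuous fun x => lconv (F x) (G x) k := by
  simp only [lconv_apply]
  rcases isEmpty_or_nonempty X with hX | ⟨⟨x₀⟩⟩
  · exact continuous_of_discreteTopology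
  have hA : 0 ≤ A := (hFd x₀).nonneg
  have hM : 0 ≤ M := (norm_nonneg _).trans (hGb x₀ 0)
  refine continuous_tsum (fun m => (hF m).mul (hG (k - m))) (hZ.summable.mul_left (A * M)) fun m x => ?_
  rw [norm_mul]
  calc ‖F x m‖ * ‖G x (k - m)‖ ≤ A * ((1 + ‖m‖) ^ 4)⁻¹ * M :=
        mul_le_mul (hFd x m) (hGb x _) (norm_nonneg _) (by positivity)
    _ = A * M * ((1 + ‖m‖) ^ 4)⁻¹ := by ring

end Conv

/-! ### The transport symbol at the order-four base -/

section Transport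

variable {K : ℕ} {A₄ A X₄ X : ℝ}

/-- **Decay of the transport symbol at the order-four base.** If the drift coefficients decay
to orders `4`, `K + 1` (constants `A₄`, `A`) and the scalar coefficients to orders `4`, `K + 1`
(constants `X₄`, `X`), then `N(U, c)` decays to order `K` with the constant
`#d · 2^K Z (A · 2πX₄ + A₄ · 2πX)` (one derivative is lost on `c`: `2πimⱼ c` has orders `3`,
`K`). [folklore] -/
theorem hasDecay_transportSym_four (hZ : HasSum (fun m : d → ℤ => ((1 + ‖m‖) ^ 4)⁻¹) Z)
    {U : d → (d → ℤ) → ℂ} {c : (d → ℤ) → ℂ} (hU₄ : ∀ j, HasDecay 4 A₄ (U j))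
    (hU : ∀ j, HasDecay (K + 1) A (U j)) (hA : 0 ≤ A) (hc₄ : HasDecay 4 X₄ c)
    (hc : HasDecay (K + 1) X c) (hX : 0 ≤ X) :
    HasDecay K (Fintype.card d * (2 ^ K * Z * (A * (2 * π * X₄) + A₄ * (2 * π * X))))
      (transportSym U c) := by
  have hX₄ : 0 ≤ X₄ := hc₄.nonneg
  have h : ∀ j ∈ (Finset.univ : Finset d),
      HasDecay K (2 ^ K * Z * (A * (2 * π * X₄) + A₄ * (2 * π * X)))
        (lconv (U j) (fun m => dsym j m * c m)) := fun j _ =>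
    hasDecay_lconv_mixed_four hZ hA (by positivity) (by positivity) (hU₄ j) (hU j)
      (hasDecay_dsym_mul (K := 3) hc₄ j) (hasDecay_dsym_mul hc j)
  intro k
  have h2 := FourierNS.hasDecay_finset_sum Finset.univ h k
  rw [Finset.sum_const, Finset.card_univ, nsmul_eq_mul] at h2
  rw [transportSym_apply]
  exact h2

/-- The transport symbol is linear in the scalar coefficients (order-four data): differences. [folklore] -/
theorem transportSym_sub_four (hZ : HasSum (fun m : d → ℤ => ((1 + ‖m‖) ^ 4)⁻¹) Z)
    {U : d → (d → ℤ) → ℂ} {c₁ c₂ : (d → ℤ) → ℂ} {X₁ X₂ : ℝ} (hU : ∀ j, HasDecay 4 A (U j))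
    (hc₁ : HasDecay 4 X₁ c₁) (hc₂ : HasDecay 4 X₂ c₂) (k : d → ℤ) :
    transportSym U c₁ k - transportSym U c₂ k = transportSym U (fun m => c₁ m - c₂ m) k := by
  simp only [transportSym_apply, ← Finset.sum_sub_distrib]
  refine Finset.sum_congr rfl fun j _ => ?_
  have h₁ := summable_lconv_term_four hZ (g := fun m => dsym j m * c₁ m) (hU j)
    (hasDecay_dsym_mul (K := 3) hc₁ j).norm_le k
  have h₂ := summable_lconv_term_four hZ (g := fun m => dsym j m * c₂ m) (hU j)
    (hasDecay_dsym_mul (K := 3) hc₂ j).norm_le k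
  rw [← lconv_sub_right (g₁ := fun m => dsym j m * c₁ m) (g₂ := fun m => dsym j m * c₂ m) k h₁ h₂]
  simp only [mul_sub]

/-- The transport symbol is linear in the drift coefficients (order-four data): differences. [folklore] -/
theorem transportSym_sub_left_four (hZ : HasSum (fun m : d → ℤ => ((1 + ‖m‖) ^ 4)⁻¹) Z)
    {U₁ U₂ : d → (d → ℤ) → ℂ} {c₀ : (d → ℤ) → ℂ} {A₁ A₂ X₁ : ℝ}
    (hU₁ : ∀ j, HasDecay 4 A₁ (U₁ j)) (hU₂ : ∀ j, HasDecay 4 A₂ (U₂ j)) (hc : HasDecay 4 X₁ c₀)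
    (k : d → ℤ) :
    transportSym U₁ c₀ k - transportSym U₂ c₀ k = transportSym (fun j m => U₁ j m - U₂ j m) c₀ k := by
  rw [transportSym_apply, transportSym_apply, transportSym_apply, ← Finset.sum_sub_distrib]
  refine Finset.sum_congr rfl fun j _ => ?_
  have h₁ := summable_lconv_term_four hZ (g := fun m => dsym j m * c₀ m) (hU₁ j)
    (hasDecay_dsym_mul (K := 3) hc j).norm_le k
  have h₂ := summable_lconv_term_four hZ (g := fun m => dsym j m * c₀ m) (hU₂ j)
    (hasDecay_dsym_mul (K := 3) hc j).norm_le k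
  exact (CorrectorFourier.lconv_sub_left (f₁ := U₁ j) (f₂ := U₂ j) (g := fun m => dsym j m * c₀ m)
    k h₁ h₂).symm

/-- Continuity in a parameter of the transport symbol (order-four data). [folklore] -/
theorem continuous_transportSym_param_four {Y : Type*} [TopologicalSpace Y]
    (hZ : HasSum (fun m : d → ℤ => ((1 + ‖m‖) ^ 4)⁻¹) Z) {U : Y → d → (d → ℤ) → ℂ}
    {c : Y → (d → ℤ) → ℂ} (hU : ∀ j m, Continuous fun y => U y j m)
    (hc : ∀ m, Continuous fun y => c y m) (hUd : ∀ y j, HasDecay 4 A (U y j))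
    (hcd : ∀ y, HasDecay 4 X (c y)) (k : d → ℤ) :
    Continuous fun y => transportSym (U y) (c y) k := by
  simp only [transportSym_apply]
  refine continuous_finsetSum _ fun j _ => ?_
  exact continuous_lconv_param_four hZ (F := fun y => U y j) (G := fun y m => dsym j m * c y m)
    (hU j) (fun m => continuous_const.mul (hc m)) (fun y => hUd y j)
    (fun y m => (hasDecay_dsym_mul (K := 3) (hcd y) j).norm_le m) k

/-- **The transport symbol vanishes at the zero frequency for a Fourier-divergence-free drift**
(order-four data): `N(U, c)(0) = -∑ₘ c(-m) ∑ⱼ 2πimⱼ Uⱼ(m) = 0`, the Fourier form of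
`∫ (u·∇)f = 0` for `div u = 0` (adapted from `CorrectorFourier.transportSym_zero_of_divFree`). [folklore] -/
theorem transportSym_zero_of_divFree_four (hZ : HasSum (fun m : d → ℤ => ((1 + ‖m‖) ^ 4)⁻¹) Z)
    {U : d → (d → ℤ) → ℂ} {c : (d → ℤ) → ℂ} (hU : ∀ j, HasDecay 4 A (U j)) (hc : HasDecay 4 X c)
    (hdiv : ∀ m, ∑ j, dsym j m * U j m = 0) : transportSym U c 0 = 0 := by
  rw [transportSym_apply]
  simp_rw [lconv_apply, zero_sub]
  have hsum : ∀ j, Summable fun m => U j m * (dsym j (-m) * c (-m)) := fun j => by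
    have := summable_lconv_term_four hZ (g := fun m => dsym j m * c m) (hU j)
      (hasDecay_dsym_mul (K := 3) hc j).norm_le 0
    simpa only [zero_sub] using this
  rw [← Summable.tsum_finsetSum (fun j _ => hsum j)]
  have hzero : ∀ m, ∑ j, U j m * (dsym j (-m) * c (-m)) = 0 := by
    intro m
    calc ∑ j, U j m * (dsym j (-m) * c (-m)) = -(c (-m) * ∑ j, dsym j m * U j m) := by
          rw [Finset.mul_sum, ← Finset.sum_neg_distrib]
          refine Finset.sum_congr rfl fun j _ => ?_
          rw [dsym_neg]; ring
      _ = 0 := by rw [hdiv m, mul_zero, neg_zero]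
  simp_rw [hzero]
  exact tsum_zero

end Transport

end PerturbedNSFourier

end Literature.Analysis.FluidPDE

end
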